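import Summits.ResolutionOfSingularities.ResolutionOfSingularities.Theorems.FrobeniusLadderFInjectiveMacaulayficationLx6c3Specimen
import Summits.ResolutionOfSingularities.ResolutionOfSingularities.Theorems.FrobeniusLadderFInjectiveMacaulayficationAS3PinchPoly
import HarnessLib

/-!
# (W-p3) THE SPECIMEN PACKAGE OF P3d4z4557 = `z³ + x⁴ + y⁵ + u⁵ + t⁷` (char 3, `d = 4`): prime, vertex closed / singular / isolated / of dimension 4 / CM, NOT FULL
# (crux `FInjectiveMacaulayfication` stmt-ResolutionOfSingularities-15315, chain w45a; res-L1-w45a-plan-1 g20/g21 RULINGs R20.3 (Q3) / R21.1 (5) / R21.6 (4)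
# «(W-p3) THE FIRST p = 3 ROW» — input side; the bed is res-L1-w45a-idea-1's d = 4 asymmetric Brieskorn–Pham triple point P3d4z4557 (FB5-r4 §3.4, `--wround`
# FULL fibre-supported fan certificate 2c8d08b741c9de3a); twin of `Lx6c3Specimen` / `Lx6q7Specimen` / `Lx6c5Specimen`; seat res-L1-w45a-stub-3 g11)

[OURS · L1 W4.5a] Support file (`--supports stmt-ResolutionOfSingularities-15315 --as helper`); def-free, unconditional; replaces the role of NO printed
item; NOT a statement of the manuscript; AI-written (AI review is weaker than expert review).

WHY. Every two-sided kernel row of the F-half census sits at `p = 2`; (W-p3) is the first characteristic-3 row. This file is the X-side of its INPUT half: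
`X 0 = x`, `X 1 = y`, `X 2 = u`, `X 3 = t`, `X 4 = z`; `f = z³ + x⁴ + y⁵ + u⁵ + t⁷`; `v` = the origin of `X = Spec k[X]/(f)`, `char k = 3` (ANY field of characteristic 3).
The point is WILD in Kouchnirenko's sense (the vertex `z³` is a face with vanishing gradient in characteristic 3 — the analogue of `z²` at `p = 2`).
* §1 `four_five_seven` (`4 = 1`, `5 = 2`, `7 = 1` in `k[X]`), `pderiv_four_f` (`∂_z f = 3z² = 0`), `pderiv_zero_f` (`∂_x f = x³`), `pderiv_one_two_f` (`∂_y f = 2y⁴`,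
  `∂_u f = 2u⁴`), `pderiv_three_f` (`∂_t f = t⁶`), `constantCoeff_f`, ★ `prime_f` (Eisenstein-type at `(x,y,u,t) = (1,1,1,0)`: `T³ + C(0)·T + C(x⁴+y⁵+u⁵+t⁷)`,
  `x⁴+y⁵+u⁵+t⁷ = 3 = 0` and `∂/∂x = 4x³ = 1 ≠ 0` there), `regular_off_vertex` (Jacobian off `𝔪`: `x³, 2y⁴, 2u⁴, t⁶`), `isIntegral_p3d4z4557`;
* §2 the germ binders at `v`: `isClosed_vertex`, `vertex_not_mem_regularLocus`, `ringKrullDim_stalk_vertex = 4`, `regular_of_ne_vertex` / `regular_off_closedPoint_vertex`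
  (ISOLATED), `cmCl_Spec_stalk_vertex`;
* §3 `f_mem_bracket` (`f ∈ 𝔪^{[3]} = (x³, y³, u³, t³, z³)` termwise), ★ `p3d4z4557_vertex_not_fullCl : ¬ FullCl 3 𝒪_{X,v}` (Fedder necessity `f² ∈ 𝔪^{[3]}`).
[folklore mathematics, OURS as a certificate; cite: Hartshorne1977, I Thm. 5.1; Matsumura1987, Thm. 17.4; Fedder1983, Prop. 1.7]
-/

-- single-problem summit: the doubled namespace component is forced
set_option linter.dupNamespace false

noncomputable section

open AlgebraicGeometry CategoryTheory Literature.AlgebraicGeometry.Resolution TopologicalSpace IsLocalRing MvPolynomial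

namespace Summit.ResolutionOfSingularities.ResolutionOfSingularities.Theorems.FInjectiveMacaulayfication.P3d4z4557Specimen

open Summit.ResolutionOfSingularities.ResolutionOfSingularities.Theorems.FInjectiveMacaulayfication
open SliceableCentre GermForm GermOfGlobalBlowup FCentreE1RungZero

/-! ## §1 Derivatives, primality, regularity off the vertex -/

/-- In characteristic `3`: `4 = 1`, `5 = 2`, `7 = 1` in `k[X]`. [folklore] -/
theorem four_five_seven (k : Type) [Field k] [CharP k 3] :
    (4 : MvPolynomial (Fin 5) k) = 1 ∧ (5 : MvPolynomial (Fin 5) k) = 2 ∧ (7 : MvPolynomial (Fin 5) k) = 1 := by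
  have h3 : (3 : MvPolynomial (Fin 5) k) = 0 := (AS3Pinch.three_eq_zero k (n := 5)).1
  refine ⟨?_, ?_, ?_⟩
  · calc (4 : MvPolynomial (Fin 5) k) = 3 + 1 := by norm_num
      _ = 1 := by rw [h3]; ring
  · calc (5 : MvPolynomial (Fin 5) k) = 3 + 2 := by norm_num
      _ = 2 := by rw [h3]; ring
  · calc (7 : MvPolynomial (Fin 5) k) = 3 + 3 + 1 := by norm_num
      _ = 1 := by rw [h3]; ring

/-- `∂f/∂z = 3z² = 0` in characteristic 3 (the wild direction). [folklore] -/
theorem pderiv_four_f (k : Type) [Field k] [CharP k 3] (f : MvPolynomial (Fin 5) k)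
    (hf : f = X 4 ^ 3 + X 0 ^ 4 + X 1 ^ 5 + X 2 ^ 5 + X 3 ^ 7) : pderiv 4 f = 0 := by
  have h3 : (3 : MvPolynomial (Fin 5) k) = 0 := (AS3Pinch.three_eq_zero k (n := 5)).1
  rw [hf]
  simp only [map_add, pderiv_pow, pderiv_X_self, pderiv_X_of_ne (show (0 : Fin 5) ≠ 4 by decide),
    pderiv_X_of_ne (show (1 : Fin 5) ≠ 4 by decide), pderiv_X_of_ne (show (2 : Fin 5) ≠ 4 by decide),
    pderiv_X_of_ne (show (3 : Fin 5) ≠ 4 by decide), mul_zero, mul_one, add_zero]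
  push_cast
  rw [h3]
  ring

/-- `∂f/∂x = 4x³ = x³` in characteristic 3. [folklore] -/
theorem pderiv_zero_f (k : Type) [Field k] [CharP k 3] (f : MvPolynomial (Fin 5) k)
    (hf : f = X 4 ^ 3 + X 0 ^ 4 + X 1 ^ 5 + X 2 ^ 5 + X 3 ^ 7) : pderiv 0 f = X 0 ^ 3 := by
  have h4 := (four_five_seven k).1
  rw [hf]
  simp only [map_add, pderiv_pow, pderiv_X_self, pderiv_X_of_ne (show (4 : Fin 5) ≠ 0 by decide),
    pderiv_X_of_ne (show (1 : Fin 5) ≠ 0 by decide), pderiv_X_of_ne (show (2 : Fin 5) ≠ 0 by decide),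
    pderiv_X_of_ne (show (3 : Fin 5) ≠ 0 by decide), mul_zero, mul_one, add_zero, zero_add]
  push_cast
  rw [h4]
  ring

/-- `∂f/∂y = 5y⁴ = 2y⁴`, `∂f/∂u = 5u⁴ = 2u⁴` in characteristic 3. [folklore] -/
theorem pderiv_one_two_f (k : Type) [Field k] [CharP k 3] (f : MvPolynomial (Fin 5) k)
    (hf : f = X 4 ^ 3 + X 0 ^ 4 + X 1 ^ 5 + X 2 ^ 5 + X 3 ^ 7) (j : Fin 5) (hj : j = 1 ∨ j = 2) :
    pderiv j f = 2 * X j ^ 4 := by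
  have h5 := (four_five_seven k).2.1
  rw [hf]
  rcases hj with rfl | rfl
  all_goals
    simp only [map_add, pderiv_pow, pderiv_X_self, pderiv_X_of_ne (show (4 : Fin 5) ≠ 1 by decide),
      pderiv_X_of_ne (show (0 : Fin 5) ≠ 1 by decide), pderiv_X_of_ne (show (2 : Fin 5) ≠ 1 by decide),
      pderiv_X_of_ne (show (3 : Fin 5) ≠ 1 by decide), pderiv_X_of_ne (show (4 : Fin 5) ≠ 2 by decide),
      pderiv_X_of_ne (show (0 : Fin 5) ≠ 2 by decide), pderiv_X_of_ne (show (1 : Fin 5) ≠ 2 by decide),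
      pderiv_X_of_ne (show (3 : Fin 5) ≠ 2 by decide), mul_zero, mul_one, zero_add, add_zero]
    push_cast
    rw [h5]

/-- `∂f/∂t = 7t⁶ = t⁶` in characteristic 3. [folklore] -/
theorem pderiv_three_f (k : Type) [Field k] [CharP k 3] (f : MvPolynomial (Fin 5) k)
    (hf : f = X 4 ^ 3 + X 0 ^ 4 + X 1 ^ 5 + X 2 ^ 5 + X 3 ^ 7) : pderiv 3 f = X 3 ^ 6 := by
  have h7 := (four_five_seven k).2.2
  rw [hf]
  simp only [map_add, pderiv_pow, pderiv_X_self, pderiv_X_of_ne (show (4 : Fin 5) ≠ 3 by decide),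
    pderiv_X_of_ne (show (0 : Fin 5) ≠ 3 by decide), pderiv_X_of_ne (show (1 : Fin 5) ≠ 3 by decide),
    pderiv_X_of_ne (show (2 : Fin 5) ≠ 3 by decide), mul_zero, mul_one, zero_add, add_zero]
  push_cast
  rw [h7]
  ring

/-- `f` has no constant term. [folklore] -/
theorem constantCoeff_f (k : Type) [Field k] (f : MvPolynomial (Fin 5) k)
    (hf : f = X 4 ^ 3 + X 0 ^ 4 + X 1 ^ 5 + X 2 ^ 5 + X 3 ^ 7) : constantCoeff f = 0 := by
  rw [hf]
  simp [constantCoeff_X]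

/-- **`f = z³ + x⁴ + y⁵ + u⁵ + t⁷` is PRIME in characteristic 3**: as `T³ + C(0)·T + C(x⁴ + y⁵ + u⁵ + t⁷)` over `k[x, y, u, t]` (`z ↦ T`), Eisenstein-type at
the point `(1, 1, 1, 0)` where `x⁴ + y⁵ + u⁵ + t⁷ = 3 = 0` and `∂/∂x = 4x³ = 1 ≠ 0` (`irreducible_X_pow_add_C_mul_X_add_C`). [folklore] -/
theorem prime_f (k : Type) [Field k] [CharP k 3] (f : MvPolynomial (Fin 5) k)
    (hf : f = X 4 ^ 3 + X 0 ^ 4 + X 1 ^ 5 + X 2 ^ 5 + X 3 ^ 7) : Prime f := by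
  set e : MvPolynomial (Fin 5) k ≃+* Polynomial (MvPolynomial (Fin 4) k) :=
    ((renameEquiv k (_root_.finRotate 5)).trans (finSuccEquiv k 4)).toRingEquiv with he_def
  have hrot4 : (_root_.finRotate 5) (4 : Fin 5) = 0 := by decide
  have hrot : ∀ j : Fin 4, (_root_.finRotate 5) (Fin.castSucc j) = j.succ := by decide
  have he4 : e (X 4) = Polynomial.X := by
    show finSuccEquiv k 4 (rename _ (X 4)) = _
    rw [rename_X, hrot4]; exact finSuccEquiv_X_zero
  have hej : ∀ j : Fin 4, e (X (Fin.castSucc j)) = Polynomial.C (X j) := fun j => by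
    show finSuccEquiv k 4 (rename _ (X (Fin.castSucc j))) = _
    rw [rename_X, hrot j]; exact finSuccEquiv_X_succ (j := j)
  set b : MvPolynomial (Fin 4) k := 0 with hb
  set c : MvPolynomial (Fin 4) k := X 0 ^ 4 + X 1 ^ 5 + X 2 ^ 5 + X 3 ^ 7 with hc
  have hef : e f = Polynomial.X ^ 3 + Polynomial.C b * Polynomial.X + Polynomial.C c := by
    rw [hf, map_add, map_add, map_add, map_add, map_pow, he4, map_pow, map_pow, map_pow, map_pow,
      show (0 : Fin 5) = Fin.castSucc (0 : Fin 4) from rfl, show (1 : Fin 5) = Fin.castSucc (1 : Fin 4) from rfl,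
      show (2 : Fin 5) = Fin.castSucc (2 : Fin 4) from rfl, show (3 : Fin 5) = Fin.castSucc (3 : Fin 4) from rfl, hej, hej, hej, hej, hb, hc]
    simp only [map_add, map_pow, map_zero, zero_mul, add_zero]
    ring
  set a : Fin 4 → k := ![1, 1, 1, 0] with ha
  have h3 : (3 : k) = 0 := by simpa using CharP.cast_eq_zero k 3
  have h4 : (4 : k) = 1 := by
    calc (4 : k) = 3 + 1 := by norm_num
      _ = 1 := by rw [h3]; ring
  have hba : MvPolynomial.eval a b = 0 := by rw [hb, map_zero]
  have hca : MvPolynomial.eval a c = 0 := by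
    rw [hc]
    simp only [map_add, map_pow, eval_X, ha, Matrix.cons_val_zero, Matrix.cons_val_one]
    simp only [Matrix.cons_val, one_pow, zero_pow (by norm_num : (7 : ℕ) ≠ 0), add_zero]
    rw [show (1 : k) + 1 + 1 = 3 by norm_num, h3]
  have hder : MvPolynomial.eval a (pderiv 0 c) ≠ 0 := by
    have e1 : pderiv 0 c = 4 * X 0 ^ 3 := by
      rw [hc, map_add, map_add, map_add, pderiv_pow, pderiv_X_self, pderiv_pow, pderiv_X_of_ne (show (1 : Fin 4) ≠ 0 by decide),
        pderiv_pow, pderiv_X_of_ne (show (2 : Fin 4) ≠ 0 by decide), pderiv_pow, pderiv_X_of_ne (show (3 : Fin 4) ≠ 0 by decide)]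
      push_cast
      ring
    rw [e1, map_mul, map_pow, eval_X, ha]
    simp only [Matrix.cons_val_zero, one_pow, mul_one]
    rw [map_ofNat, h4]
    exact one_ne_zero
  have hirr : Irreducible (e f) := by
    rw [hef]
    exact Literature.AlgebraicGeometry.Motives.SmoothHypersurface.irreducible_X_pow_add_C_mul_X_add_C (d := 3) (by norm_num) b c a hba hca 0 hder
  exact (MulEquiv.prime_iff e).mp hirr.prime

/-- `2` is a unit in characteristic 3: `2y ∈ P ⇒ y ∈ P` for any ideal `P` of `k[X]`. [folklore] -/
theorem mem_of_two_mul_mem (k : Type) [Field k] [CharP k 3] (P : Ideal (MvPolynomial (Fin 5) k)) (y : MvPolynomial (Fin 5) k)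
    (h : 2 * y ∈ P) : y ∈ P := by
  have h22 : (2 : MvPolynomial (Fin 5) k) * 2 = 1 := (AS3Pinch.three_eq_zero k (n := 5)).2
  have : (2 : MvPolynomial (Fin 5) k) * (2 * y) ∈ P := Ideal.mul_mem_left _ _ h
  rwa [← mul_assoc, h22, one_mul] at this

/-- **`(k[X]/(f))_P` is regular at every prime `P ⊉ (x̄, ȳ, ū, t̄, z̄)`**: some variable other than `z` misses `P` (`z³ = f − x⁴ − y⁵ − u⁵ − t⁷`), and the
corresponding partial `x³`, `2y⁴`, `2u⁴`, `t⁶` misses `P` (Jacobian criterion). [cite: Hartshorne1977, I Thm. 5.1] -/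
theorem regular_off_vertex (k : Type) [Field k] [CharP k 3] (f : MvPolynomial (Fin 5) k)
    (hf : f = X 4 ^ 3 + X 0 ^ 4 + X 1 ^ 5 + X 2 ^ 5 + X 3 ^ 7)
    (P : Ideal (MvPolynomial (Fin 5) k ⧸ Ideal.span {f})) [P.IsPrime]
    (hP : ¬ Ideal.span (Set.range fun j : Fin 5 => Ideal.Quotient.mk (Ideal.span {f}) (X j)) ≤ P) :
    IsRegularLocalRing (Localization.AtPrime P) := by
  have hP' : (P.comap (Ideal.Quotient.mk (Ideal.span {f}))).IsPrime := Ideal.comap_isPrime _ _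
  set P' := P.comap (Ideal.Quotient.mk (Ideal.span {f})) with hP'def
  have hex : ∃ j : Fin 5, j ≠ 4 ∧ (X j : MvPolynomial (Fin 5) k) ∉ P' := by
    by_contra hall
    push Not at hall
    apply hP
    rw [Ideal.span_le]
    rintro _ ⟨j, rfl⟩
    change X j ∈ P'
    by_cases hj : j = 4
    · subst hj
      have hfP : f ∈ P' := FermatCubicConeChar2.self_mem_comap f P
      have hx : (X 0 : MvPolynomial (Fin 5) k) ∈ P' := hall 0 (by decide)
      have hy : (X 1 : MvPolynomial (Fin 5) k) ∈ P' := hall 1 (by decide)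
      have hu : (X 2 : MvPolynomial (Fin 5) k) ∈ P' := hall 2 (by decide)
      have ht : (X 3 : MvPolynomial (Fin 5) k) ∈ P' := hall 3 (by decide)
      have hz3 : (X 4 : MvPolynomial (Fin 5) k) ^ 3 ∈ P' := by
        have e : (X 4 : MvPolynomial (Fin 5) k) ^ 3 = f - (X 0 ^ 4 + X 1 ^ 5 + X 2 ^ 5 + X 3 ^ 7) := by rw [hf]; ring
        rw [e]
        refine Ideal.sub_mem _ hfP (Ideal.add_mem _ (Ideal.add_mem _ (Ideal.add_mem _ ?_ ?_) ?_) ?_)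
        · exact Ideal.pow_mem_of_mem _ hx 4 (by norm_num)
        · exact Ideal.pow_mem_of_mem _ hy 5 (by norm_num)
        · exact Ideal.pow_mem_of_mem _ hu 5 (by norm_num)
        · exact Ideal.pow_mem_of_mem _ ht 7 (by norm_num)
      exact hP'.mem_of_pow_mem 3 hz3
    · exact hall j hj
  obtain ⟨j, hj4, hj⟩ := hex
  by_cases hj0 : j = 0
  · subst hj0
    exact HypersurfaceRegular.stub_hypersurfaceRegularOfPderiv k 5 f 0 P
      (by rw [pderiv_zero_f k f hf]; exact fun h => hj (hP'.mem_of_pow_mem 3 h))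
  · by_cases hj3 : j = 3
    · subst hj3
      exact HypersurfaceRegular.stub_hypersurfaceRegularOfPderiv k 5 f 3 P
        (by rw [pderiv_three_f k f hf]; exact fun h => hj (hP'.mem_of_pow_mem 6 h))
    · have hj12 : j = 1 ∨ j = 2 := by
        fin_cases j <;> simp_all
      exact HypersurfaceRegular.stub_hypersurfaceRegularOfPderiv k 5 f j P
        (by rw [pderiv_one_two_f k f hf j hj12]; exact fun h => hj (hP'.mem_of_pow_mem 4 (mem_of_two_mul_mem k P' _ h)))

/-- `X` is integral. [folklore] -/
theorem isIntegral_p3d4z4557 (k : Type) [Field k] [CharP k 3] (f : MvPolynomial (Fin 5) k)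
    (hf : f = X 4 ^ 3 + X 0 ^ 4 + X 1 ^ 5 + X 2 ^ 5 + X 3 ^ 7) :
    IsIntegral (Spec (.of (MvPolynomial (Fin 5) k ⧸ Ideal.span {f}))) := by
  haveI := (Ideal.span_singleton_prime (prime_f k f hf).ne_zero).mpr (prime_f k f hf)
  haveI : IsDomain (MvPolynomial (Fin 5) k ⧸ Ideal.span {f}) := Ideal.Quotient.isDomain _
  infer_instance

/-! ## §2 The binders at the vertex -/

/-- (H1) the vertex is closed. [folklore] -/
theorem isClosed_vertex (k : Type) [Field k] (f : MvPolynomial (Fin 5) k)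
    (hf : f = X 4 ^ 3 + X 0 ^ 4 + X 1 ^ 5 + X 2 ^ 5 + X 3 ^ 7)
    (v : Spec (.of (MvPolynomial (Fin 5) k ⧸ Ideal.span {f})))
    (hv : v.asIdeal = Ideal.span (Set.range fun j : Fin 5 => Ideal.Quotient.mk (Ideal.span {f}) (X j))) :
    IsClosed ({v} : Set (Spec (.of (MvPolynomial (Fin 5) k ⧸ Ideal.span {f})))) :=
  DoublePointFermatCubicGerm.isClosed_origin k f (constantCoeff_f k f hf) v hv

/-- (H2) the vertex is NOT regular: `f(0) = 0`, `∇f(0) = 0`. [cite: Hartshorne1977, I Thm. 5.1] -/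
theorem vertex_not_mem_regularLocus (k : Type) [Field k] [CharP k 3] (f : MvPolynomial (Fin 5) k)
    (hf : f = X 4 ^ 3 + X 0 ^ 4 + X 1 ^ 5 + X 2 ^ 5 + X 3 ^ 7)
    (v : Spec (.of (MvPolynomial (Fin 5) k ⧸ Ideal.span {f})))
    (hv : v.asIdeal = Ideal.span (Set.range fun j : Fin 5 => Ideal.Quotient.mk (Ideal.span {f}) (X j))) :
    v ∉ Scheme.regularLocus (Spec (.of (MvPolynomial (Fin 5) k ⧸ Ideal.span {f}))) := by
  classical
  refine not_mem_regularLocus_Spec_of_not_isRegularLocalRing v ?_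
  refine not_isRegularLocalRing_localization_of_pderiv_eval_eq_zero (0 : Fin 5 → k) (prime_f k f hf).ne_zero ?_ ?_ v.asIdeal ?_
  · rw [MvPolynomial.eval_zero]
    exact constantCoeff_f k f hf
  · intro i
    by_cases hi4 : i = 4
    · subst hi4
      rw [pderiv_four_f k f hf, map_zero]
    by_cases hi0 : i = 0
    · subst hi0
      rw [pderiv_zero_f k f hf, map_pow, MvPolynomial.eval_X, Pi.zero_apply, zero_pow (by norm_num)]
    by_cases hi3 : i = 3
    · subst hi3
      rw [pderiv_three_f k f hf, map_pow, MvPolynomial.eval_X, Pi.zero_apply, zero_pow (by norm_num)]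
    · have hi : i = 1 ∨ i = 2 := by fin_cases i <;> simp_all
      rw [pderiv_one_two_f k f hf i hi, map_mul, map_pow, MvPolynomial.eval_X, Pi.zero_apply, zero_pow (by norm_num), mul_zero]
  · rw [hv, DoublePointFermatCubicGerm.comap_origin k f (constantCoeff_f k f hf), MvPolynomial.eval_zero, Fedder.span_range_X_eq_ker]

/-- (H3) `dim 𝒪_{X,v} = 4`. [cite: Matsumura1987, Thm. 13.5] -/
theorem ringKrullDim_stalk_vertex (k : Type) [Field k] [CharP k 3] (f : MvPolynomial (Fin 5) k)
    (hf : f = X 4 ^ 3 + X 0 ^ 4 + X 1 ^ 5 + X 2 ^ 5 + X 3 ^ 7)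
    (v : Spec (.of (MvPolynomial (Fin 5) k ⧸ Ideal.span {f})))
    (hv : v.asIdeal = Ideal.span (Set.range fun j : Fin 5 => Ideal.Quotient.mk (Ideal.span {f}) (X j))) :
    ringKrullDim ((Spec (.of (MvPolynomial (Fin 5) k ⧸ Ideal.span {f}))).presheaf.stalk v) = (4 : ℕ) := by
  haveI : v.asIdeal.IsMaximal := by
    rw [hv]
    exact DoublePointFermatCubicGerm.isMaximal_origin k f (constantCoeff_f k f hf)
  rw [ringKrullDim_stalk_Spec_eq]
  exact HypersurfaceLocalDim.stub_hypersurfaceLocalDim k 4 f (prime_f k f hf).ne_zero v.asIdeal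

/-- `X` is regular at every point other than the vertex. [cite: Hartshorne1977, I Thm. 5.1] -/
theorem regular_of_ne_vertex (k : Type) [Field k] [CharP k 3] (f : MvPolynomial (Fin 5) k)
    (hf : f = X 4 ^ 3 + X 0 ^ 4 + X 1 ^ 5 + X 2 ^ 5 + X 3 ^ 7)
    (v : Spec (.of (MvPolynomial (Fin 5) k ⧸ Ideal.span {f})))
    (hv : v.asIdeal = Ideal.span (Set.range fun j : Fin 5 => Ideal.Quotient.mk (Ideal.span {f}) (X j))) :
    ∀ y : Spec (.of (MvPolynomial (Fin 5) k ⧸ Ideal.span {f})), y ⤳ v → y ≠ v →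
      y ∈ Scheme.regularLocus (Spec (.of (MvPolynomial (Fin 5) k ⧸ Ideal.span {f}))) := by
  intro y hy hne
  refine FermatCubicConeGerm.mem_regularLocus_Spec_of_isRegularLocalRing y (regular_off_vertex k f hf y.asIdeal fun hle => hne ?_)
  have h2 : y.asIdeal ≤ v.asIdeal := (PrimeSpectrum.le_iff_specializes y v).mpr hy
  exact PrimeSpectrum.ext (le_antisymm h2 (hv ▸ hle))

/-- (H4) ISOLATED: `Spec 𝒪_{X,v}` is regular off its closed point. [cite: Temkin2008, §2.1] -/
theorem regular_off_closedPoint_vertex (k : Type) [Field k] [CharP k 3] (f : MvPolynomial (Fin 5) k)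
    (hf : f = X 4 ^ 3 + X 0 ^ 4 + X 1 ^ 5 + X 2 ^ 5 + X 3 ^ 7)
    (v : Spec (.of (MvPolynomial (Fin 5) k ⧸ Ideal.span {f})))
    (hv : v.asIdeal = Ideal.span (Set.range fun j : Fin 5 => Ideal.Quotient.mk (Ideal.span {f}) (X j))) :
    ∀ s : Spec ((Spec (.of (MvPolynomial (Fin 5) k ⧸ Ideal.span {f}))).presheaf.stalk v),
      s ≠ closedPoint _ → s ∈ Scheme.regularLocus (Spec ((Spec (.of (MvPolynomial (Fin 5) k ⧸ Ideal.span {f}))).presheaf.stalk v)) :=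
  regularLocus_Spec_stalk_of_isolated v (regular_of_ne_vertex k f hf v hv)

/-- (H5) the CM-clause at every point of `Spec 𝒪_{X,v}`. [cite: Matsumura1987, Thm. 17.4 and Thm. 17.8] -/
theorem cmCl_Spec_stalk_vertex (k : Type) [Field k] [CharP k 3] (f : MvPolynomial (Fin 5) k)
    (hf : f = X 4 ^ 3 + X 0 ^ 4 + X 1 ^ 5 + X 2 ^ 5 + X 3 ^ 7)
    (v : Spec (.of (MvPolynomial (Fin 5) k ⧸ Ideal.span {f})))
    (hv : v.asIdeal = Ideal.span (Set.range fun j : Fin 5 => Ideal.Quotient.mk (Ideal.span {f}) (X j))) :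
    ∀ s : Spec ((Spec (.of (MvPolynomial (Fin 5) k ⧸ Ideal.span {f}))).presheaf.stalk v),
      CMCl ((Spec ((Spec (.of (MvPolynomial (Fin 5) k ⧸ Ideal.span {f}))).presheaf.stalk v)).presheaf.stalk s) :=
  cmCl_Spec_stalk_of_isolated v (cmCl_stalk_Spec_of_cmCl_localization v
    (DoublePointFermatCubicGerm.cmCl_localization_hypersurface k f (prime_f k f hf).ne_zero v)) (regular_of_ne_vertex k f hf v hv)

/-! ## §3 The vertex is a BAD point -/

/-- `f ∈ 𝔪^{[3]} = (x³, y³, u³, t³, z³)`: every monomial `z³, x⁴, y⁵, u⁵, t⁷` is divisible by the cube of a variable. [certificate; cite: Fedder1983, Prop. 1.7] -/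
theorem f_mem_bracket (k : Type) [Field k] (f : MvPolynomial (Fin 5) k)
    (hf : f = X 4 ^ 3 + X 0 ^ 4 + X 1 ^ 5 + X 2 ^ 5 + X 3 ^ 7) :
    f ∈ Ideal.span (Set.range fun i : Fin 5 => (X i : MvPolynomial (Fin 5) k) ^ 3) := by
  have hcu : ∀ j : Fin 5, (X j : MvPolynomial (Fin 5) k) ^ 3 ∈ Ideal.span (Set.range fun i : Fin 5 => (X i : MvPolynomial (Fin 5) k) ^ 3) :=
    fun j => Ideal.subset_span ⟨j, rfl⟩
  rw [hf]
  refine Ideal.add_mem _ (Ideal.add_mem _ (Ideal.add_mem _ (Ideal.add_mem _ (hcu 4) ?_) ?_) ?_) ?_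
  · rw [show (X 0 : MvPolynomial (Fin 5) k) ^ 4 = X 0 ^ 3 * X 0 by ring]
    exact Ideal.mul_mem_right _ _ (hcu 0)
  · rw [show (X 1 : MvPolynomial (Fin 5) k) ^ 5 = X 1 ^ 3 * X 1 ^ 2 by ring]
    exact Ideal.mul_mem_right _ _ (hcu 1)
  · rw [show (X 2 : MvPolynomial (Fin 5) k) ^ 5 = X 2 ^ 3 * X 2 ^ 2 by ring]
    exact Ideal.mul_mem_right _ _ (hcu 2)
  · rw [show (X 3 : MvPolynomial (Fin 5) k) ^ 7 = X 3 ^ 3 * X 3 ^ 4 by ring]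
    exact Ideal.mul_mem_right _ _ (hcu 3)

/-- ★ **The vertex of P3d4z4557 is NOT FULL**: `f² ∈ 𝔪^{[3]}` since already `f ∈ 𝔪^{[3]}` (Fedder necessity,
`HypersurfaceOriginNotFull.not_fullCl_stalk_origin_of_fedder_mem` at `p = 3`). [cite: Fedder1983, Prop. 1.7] -/
theorem p3d4z4557_vertex_not_fullCl (k : Type) [Field k] [CharP k 3] (f : MvPolynomial (Fin 5) k)
    (hf : f = X 4 ^ 3 + X 0 ^ 4 + X 1 ^ 5 + X 2 ^ 5 + X 3 ^ 7)
    (v : Spec (.of (MvPolynomial (Fin 5) k ⧸ Ideal.span {f})))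
    (hv : v.asIdeal = Ideal.span (Set.range fun j : Fin 5 => Ideal.Quotient.mk (Ideal.span {f}) (X j))) :
    ¬ FullCl 3 ((Spec (.of (MvPolynomial (Fin 5) k ⧸ Ideal.span {f}))).presheaf.stalk v) := by
  haveI : Fact (Nat.Prime 3) := ⟨Nat.prime_three⟩
  refine HypersurfaceOriginNotFull.not_fullCl_stalk_origin_of_fedder_mem 3 k f (prime_f k f hf).ne_zero (constantCoeff_f k f hf) ?_ v hv
  rw [show (3 - 1 : ℕ) = 2 from rfl, pow_two]
  exact Ideal.mul_mem_left _ _ (f_mem_bracket k f hf)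

end Summit.ResolutionOfSingularities.ResolutionOfSingularities.Theorems.FInjectiveMacaulayfication.P3d4z4557Specimen

end
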